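import Mathlib.Analysis.SpecialFunctions.Log.Deriv
import Mathlib.Analysis.SpecialFunctions.Sqrt
import Mathlib.Analysis.SpecialFunctions.Pow.Real
import Mathlib.Analysis.SpecialFunctions.SmoothTransition
import Literature.Geometry.Lorentzian.KerrData
import HarnessLib

/-!
# Crux `SwallowTheDatum.UniversalWitnessFamily` (stmt-FinalStateConjecture-10051), line `Sketch`,
# stub `stub_regionOneDecomposition` — part 1: the explicit functions of the Schwarzschild exterior

Elementary real analysis of the functions entering the explicit `N = 1` decomposition of the
Schwarzschild exterior `{r > 2M}` in ingoing Kerr–Schild coordinates (`Kerr.region 0 (2M)`,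
`Kerr.bilin M 0 = η + (2M/r) ℓ ⊗ ℓ`):

* `torH M r = 2M log(r/2M − 1)` — the tortoise height `r* − r`, i.e. the ingoing Kerr–Schild time of
  the static slice `{t = 0}` (`t = t* − torH`), and twice it is the outgoing Kerr–Schild time shift;
  `torH_nonneg` (`r ≥ 4M`), `torH_le` (`torH ≤ r`), `hasDerivAt_torH` (`torH' = 2M/(r − 2M)`),
  `contDiffOn_torH`;
* `staticTime M x = x⁰ − torH M ‖x̲‖` — static (Schwarzschild) time of a Kerr–Schild point;
* `growth M τ = M (1 + (τ/M)²)^{1/4}` (smooth, even, `≥ M`, monotone on `τ ≥ 0`, `~ √(Mτ)`,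
  `growth/τ → 0`, `growth → ∞`) and the three radii built from it: the flat excision
  `excision = 4M + growth`, the certified hole radius `certRadius = 4M + 2·growth` and the exact-zone
  radius `exactRadius = 4M + 4·growth` (`excision < certRadius < exactRadius`);
* the coordinate maps of the two charts: `bend`/`bentMap` (identity on the exact zone `{r ≤ S(t*)}`, shift
  to static time beyond `2S(t*)`), the time squash `timeSquash`/`squashMap` onto `{x⁰ > τ₀}` and the hole
  map `holeMap = bentMap ∘ squashMap τ₀`; the flat (outgoing Kerr–Schild) map `outMap`;
* the vertical curves `vert x s = x + s e₀` of the exterior `Kerr.region 0 (2M)` and its time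
  orientation `ksTime` (that of `Kerr.spacetime M 0 (2M)`, by `rfl`).

References: Misner–Thorne–Wheeler 1973, §31.4–31.5 (Eddington–Finkelstein / tortoise coordinate);
Dafermos–Rodnianski arXiv:0811.0354, §5.1; O'Neill 1983, Ch. 13.
-/

set_option linter.dupNamespace false

noncomputable section

open scoped Manifold ContDiff Topology
open Set Function Filter Literature.Geometry.Lorentzian

namespace Summit.FinalStateConjecture.FinalStateConjecture.Theorems.SwallowTheDatum.UniversalWitnessFamily

/-! ## The tortoise height `torH M r = 2M log(r/2M − 1)` -/

/-- The **tortoise height** `torH M r = 2M log(r/2M − 1) = r* − r` of the Schwarzschild exterior: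
the ingoing Kerr–Schild time `t*` of the static slice `{t = 0}` at areal radius `r`
(`t = t* − torH`). MTW 1973, (31.10)–(31.17). -/
def torH (M r : ℝ) : ℝ := 2 * M * Real.log (r / (2 * M) - 1)

/-- Unfolding lemma for `torH`. -/
theorem torH_eq (M r : ℝ) : torH M r = 2 * M * Real.log (r / (2 * M) - 1) := rfl

/-- For `r > 2M > 0`, `r/2M − 1 = (r − 2M)/2M > 0`. -/
theorem div_two_mul_sub_one_pos {M r : ℝ} (hM : 0 < M) (hr : 2 * M < r) : 0 < r / (2 * M) - 1 := by
  rw [sub_pos, lt_div_iff₀ (by positivity)]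
  linarith

/-! ## Static time -/

/-- The **static (Schwarzschild) time** `t = t* − torH(‖x̲‖)` of the Kerr–Schild point `x = (t*, x̲)`.
MTW 1973, (31.17). -/
def staticTime (M : ℝ) (x : E4) : ℝ := x 0 - torH M (E4.spatialNorm x)

/-- Unfolding lemma for `staticTime`. -/
theorem staticTime_eq (M : ℝ) (x : E4) : staticTime M x = x 0 - torH M (E4.spatialNorm x) := rfl

/-- Static time along the vertical line through `x`: `t(x + s e₀) = t(x) + s`. -/
theorem staticTime_add_smul_basisVector (M : ℝ) (x : E4) (s : ℝ) :
    staticTime M (x + s • E4.basisVector 0) = staticTime M x + s := by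
  unfold staticTime
  have h1 : (x + s • E4.basisVector 0) 0 = x 0 + s := by simp
  have h2 : E4.spatialNorm (x + s • E4.basisVector 0) = E4.spatialNorm x := by
    unfold E4.spatialNorm
    congr 1
    ext i
    simp [E4.spatial_apply, Fin.succ_ne_zero]
  rw [h1, h2]
  ring

/-! ## The growth profile and the three radii -/

/-- The **growth profile** `growth M τ = M (1 + (τ/M)²)^{1/4}`: smooth on all of `ℝ`, `≥ M`,
`~ √(Mτ)`. -/
def growth (M τ : ℝ) : ℝ := M * Real.sqrt (Real.sqrt (1 + (τ / M) ^ 2))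

/-- Unfolding lemma for `growth`. -/
theorem growth_eq (M τ : ℝ) : growth M τ = M * Real.sqrt (Real.sqrt (1 + (τ / M) ^ 2)) := rfl

/-- `growth M τ ≥ M`. -/
theorem le_growth {M : ℝ} (hM : 0 < M) (τ : ℝ) : M ≤ growth M τ := by
  unfold growth
  have h1 : 1 ≤ 1 + (τ / M) ^ 2 := by nlinarith [sq_nonneg (τ / M)]
  have h2 : 1 ≤ Real.sqrt (1 + (τ / M) ^ 2) := Real.one_le_sqrt.2 h1
  have h3 : 1 ≤ Real.sqrt (Real.sqrt (1 + (τ / M) ^ 2)) := Real.one_le_sqrt.2 h2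
  nlinarith

/-- `growth M τ > 0` for `M > 0`. -/
theorem growth_pos {M : ℝ} (hM : 0 < M) (τ : ℝ) : 0 < growth M τ := hM.trans_le (le_growth hM τ)

/-- The **flat excision radius** `ρ(τ) = 4M + growth M τ` (`≥ 5M`, `o(τ)`). -/
def excision (M τ : ℝ) : ℝ := 4 * M + growth M τ

/-- The **certified hole radius** `R(τ) = 4M + 2 growth M τ`. -/
def certRadius (M τ : ℝ) : ℝ := 4 * M + 2 * growth M τ

/-- The **exact-zone radius** `S(τ) = 4M + 4 growth M τ` (the hole chart is the identity on
`{r ≤ S(t*)}` and bends to static time on `{S ≤ r ≤ 2S}`). -/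
def exactRadius (M τ : ℝ) : ℝ := 4 * M + 4 * growth M τ

/-- Unfolding lemma for `excision`. -/
theorem excision_eq (M τ : ℝ) : excision M τ = 4 * M + growth M τ := rfl
/-- Unfolding lemma for `certRadius`. -/
theorem certRadius_eq (M τ : ℝ) : certRadius M τ = 4 * M + 2 * growth M τ := rfl
/-- Unfolding lemma for `exactRadius`. -/
theorem exactRadius_eq (M τ : ℝ) : exactRadius M τ = 4 * M + 4 * growth M τ := rfl

/-- `4M < ρ(τ)`: the flat domain stays beyond `r = 4M` (where the tortoise height is nonnegative). -/
theorem four_mul_lt_excision {M : ℝ} (hM : 0 < M) (τ : ℝ) : 4 * M < excision M τ := by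
  unfold excision; linarith [growth_pos hM τ]

/-- `ρ(τ) < R(τ)`: no annulus gap between the flat excision and the certified hole radius. -/
theorem excision_lt_certRadius {M : ℝ} (hM : 0 < M) (τ : ℝ) : excision M τ < certRadius M τ := by
  unfold excision certRadius; linarith [growth_pos hM τ]

/-- `R(τ) < S(τ)`: the certified near zone lies inside the exact zone of the hole chart. -/
theorem certRadius_lt_exactRadius {M : ℝ} (hM : 0 < M) (τ : ℝ) :
    certRadius M τ < exactRadius M τ := by
  unfold certRadius exactRadius; linarith [growth_pos hM τ]

/-- `4M ≤ R(τ)`. -/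
theorem four_mul_le_certRadius {M : ℝ} (hM : 0 < M) (τ : ℝ) : 4 * M ≤ certRadius M τ := by
  unfold certRadius; linarith [growth_pos hM τ]

/-- `2M < S(τ)`. -/
theorem two_mul_lt_exactRadius {M : ℝ} (hM : 0 < M) (τ : ℝ) : 2 * M < exactRadius M τ := by
  unfold exactRadius; linarith [growth_pos hM τ]

/-- `S(τ) > 0`. -/
theorem exactRadius_pos {M : ℝ} (hM : 0 < M) (τ : ℝ) : 0 < exactRadius M τ := by
  linarith [two_mul_lt_exactRadius hM τ]

/-! ## The charts' coordinate maps (all total maps `E4 → E4`; only their values on `{r > 2M}` matter) -/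

/-- The **bending** `β(t*, r) = torH(r) · χ(r/S(t*) − 1)` of the hole chart, `χ = Real.smoothTransition`:
zero on the exact zone `{r ≤ S(t*)}`, the full tortoise height (static time shift) on `{r ≥ 2S(t*)}`. -/
def bend (M t r : ℝ) : ℝ := torH M r * Real.smoothTransition (r / exactRadius M t - 1)

/-- Unfolding lemma for `bend`. -/
theorem bend_eq (M t r : ℝ) : bend M t r = torH M r * Real.smoothTransition (r / exactRadius M t - 1) := rfl

/-- `bend = 0` on the exact zone `{r ≤ S(t*)}`. -/
theorem bend_eq_zero_of_le {M t r : ℝ} (hM : 0 < M) (h : r ≤ exactRadius M t) : bend M t r = 0 := by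
  unfold bend
  rw [Real.smoothTransition.zero_of_nonpos, mul_zero]
  rw [sub_nonpos, div_le_one (exactRadius_pos hM t)]
  exact h

/-- `bend = torH` on the far zone `{r ≥ 2S(t*)}`. -/
theorem bend_eq_torH_of_le {M t r : ℝ} (hM : 0 < M) (h : 2 * exactRadius M t ≤ r) : bend M t r = torH M r := by
  unfold bend
  rw [Real.smoothTransition.one_of_one_le, mul_one]
  rw [le_sub_iff_add_le, le_div_iff₀ (exactRadius_pos hM t)]
  linarith

/-- The **bent map** `x ↦ x + β(x⁰, ‖x̃‖) e₀` (the late part of the hole chart, in Kerr–Schild coordinates: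
the identity on the exact zone, the shift to static time far out). -/
def bentMap (M : ℝ) (x : E4) : E4 := x + bend M (x 0) (E4.spatialNorm x) • E4.basisVector 0

/-- Unfolding lemma for `bentMap`. -/
theorem bentMap_eq (M : ℝ) (x : E4) :
    bentMap M x = x + bend M (x 0) (E4.spatialNorm x) • E4.basisVector 0 := rfl

/-- The **time squash** `σ(t) = τ₀ + 1 + (t − τ₀ − 1)·χ(t − τ₀)`: smooth, values in `(τ₀, ∞)`, the identity
on `[τ₀ + 1, ∞)` (verbatim the reparametrisation of `EIHFluxBalanceInertialRecessionRechart`). -/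
def timeSquash (τ₀ t : ℝ) : ℝ := τ₀ + 1 + (t - τ₀ - 1) * Real.smoothTransition (t - τ₀)

/-- Unfolding lemma for `timeSquash`. -/
theorem timeSquash_eq (τ₀ t : ℝ) :
    timeSquash τ₀ t = τ₀ + 1 + (t - τ₀ - 1) * Real.smoothTransition (t - τ₀) := rfl

/-- The **squash map** `x ↦ x + (σ(x⁰) − x⁰) e₀` (re-times all of `E4` into the half-space `{x⁰ > τ₀}`,
identity on `{x⁰ ≥ τ₀ + 1}`). -/
def squashMap (τ₀ : ℝ) (x : E4) : E4 := x + (timeSquash τ₀ (x 0) - x 0) • E4.basisVector 0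

/-- Unfolding lemma for `squashMap`. -/
theorem squashMap_eq (τ₀ : ℝ) (x : E4) :
    squashMap τ₀ x = x + (timeSquash τ₀ (x 0) - x 0) • E4.basisVector 0 := rfl

/-- The **hole chart's coordinate map** `bentMap ∘ squashMap τ₀` (smooth on `{r > 2M} × ℝ`; equal to
`bentMap` on `{x⁰ ≥ τ₀ + 1}`). -/
def holeMap (M τ₀ : ℝ) (x : E4) : E4 := bentMap M (squashMap τ₀ x)

/-- Unfolding lemma for `holeMap`. -/
theorem holeMap_eq (M τ₀ : ℝ) (x : E4) : holeMap M τ₀ x = bentMap M (squashMap τ₀ x) := rfl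

/-- The **flat chart's coordinate map** `x ↦ x + 2 torH(‖x̃‖) e₀`: outgoing Eddington–Finkelstein /
Kerr–Schild time `x⁰` to ingoing Kerr–Schild time `x⁰ + 2(r* − r)`. -/
def outMap (M : ℝ) (x : E4) : E4 := x + (2 * torH M (E4.spatialNorm x)) • E4.basisVector 0

/-- Unfolding lemma for `outMap`. -/
theorem outMap_eq (M : ℝ) (x : E4) :
    outMap M x = x + (2 * torH M (E4.spatialNorm x)) • E4.basisVector 0 := rfl

/-! ## The vertical curves and the time orientation of the Schwarzschild exterior -/

section Region

variable {M : ℝ}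

/-- The vertical translate `x + s e₀` stays in the region (same spatial part). -/
theorem add_smul_basisVector_mem {x : E4} (hx : x ∈ Kerr.region 0 (Kerr.rPlus M 0)) (s : ℝ) :
    x + s • E4.basisVector 0 ∈ Kerr.region 0 (Kerr.rPlus M 0) := by
  rw [Kerr.mem_region, Kerr.radius_zero_left] at hx ⊢
  have : E4.spatialNorm (x + s • E4.basisVector 0) = E4.spatialNorm x := by
    unfold E4.spatialNorm
    congr 1
    ext i
    simp [E4.spatial_apply, Fin.succ_ne_zero]
  rwa [this]

/-- The **vertical curve** `s ↦ x + s e₀` through a point of the region (an orbit of the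
stationary Killing field `∂_{t*}`). -/
def vert (x : Kerr.region 0 (Kerr.rPlus M 0)) (s : ℝ) : Kerr.region 0 (Kerr.rPlus M 0) :=
  ⟨x.1 + s • E4.basisVector 0, add_smul_basisVector_mem x.2 s⟩

/-- The vertical curve in coordinates. -/
theorem vert_coe (x : Kerr.region 0 (Kerr.rPlus M 0)) (s : ℝ) :
    ((vert x s : Kerr.region 0 (Kerr.rPlus M 0)) : E4) = x.1 + s • E4.basisVector 0 := rfl

variable [Kerr.Facts]

/-- The future time orientation of the Schwarzschild exterior at smoothness `∞` (the orientation of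
`Kerr.spacetime M 0 (2M)`, by `rfl`). -/
def ksTime (hM : 0 ≤ M) : TimeOrientation (Kerr.smoothMetric M 0 (Kerr.rPlus M 0)) :=
  (Kerr.timeOrientation M 0 (Kerr.rPlus M 0) hM).ofLE le_top

/-- Unfolding lemma for `ksTime`. -/
theorem ksTime_eq (hM : 0 ≤ M) :
    ksTime hM = (Kerr.timeOrientation M 0 (Kerr.rPlus M 0) hM).ofLE le_top := rfl

end Region


/-- **Anchor of part 1** (registered sub-goal of `stub_regionOneDecomposition`): the three radii are
strictly ordered, `ρ(τ) < R(τ) < S(τ)` — no annulus gap, and the certified near zone is exact. -/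
theorem regionOneBasics_anchor : ∀ (M τ : ℝ), 0 < M → excision M τ < certRadius M τ ∧ certRadius M τ < exactRadius M τ := by
  intro M τ hM
  exact ⟨excision_lt_certRadius hM τ, certRadius_lt_exactRadius hM τ⟩

end Summit.FinalStateConjecture.FinalStateConjecture.Theorems.SwallowTheDatum.UniversalWitnessFamily

end
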